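import Literature.AlgebraicGeometry.Resolution.LUComplete3TrustBase
import Literature.AlgebraicGeometry.Resolution.ArithmeticalThreefoldsReduction
import Mathlib.RingTheory.Valuation.Integral
import HarnessLib

/-!
# Cossart–Piltant 2019 Thm. 1.5 (weak local-uniformization form) FROM Thm. 1.1 as printed

Topic: `Literature/AlgebraicGeometry/Resolution`. PROVED edge; nothing is vendored.

The named fact `CossartPiltant2019Local` (`ArithmeticalThreefoldsLocal.lean`: Cossart–Piltant 2019,
journal Thm. 1.5, in the weak form "for `S` excellent regular local of dimension three, `h ∈ S[X]`
monic of degree `p` in case (i)/(ii), `L = Frac(S)[X]/(h)` and a valuation ring `O ∋ S` of `L`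
dominating `S`, some `S[x][t] ⊆ O` is regular at the centre") is a CONSEQUENCE of Thm. 1.1 as
printed (`CossartPiltant2019General`): `S[x] ≅ S[X]/(h)` is a quasi-excellent domain (finite type
over the excellent `S`, Stacks 07QU) of dimension `3` (integral over `S`, `h` monic), its fraction
field is `L` (`L = K(x)`, denominators cleared into `S`), and `x ∈ O` (integral over `S ⊆ O`); so
Thm. 1.1 applied to `Spec S[x]` and read along `O` (`CossartPiltant2019General.exists_fg_regular`)
gives `S[x][t] ⊆ O` regular at the centre. Neither the degree, nor irreducibility, nor the case
distinction (i)/(ii), nor the domination is used.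

* `CossartPiltant2019General.cossartPiltant2019Local : CossartPiltant2019General → CossartPiltant2019Local`.

In the paper Thm. 1.1 is deduced FROM Thm. 1.5 (Props. 4.8, 4.10), so this records a trust base,
not a line of proof. AI-written; weaker than expert review.

## Sources

* V. Cossart, O. Piltant, J. Algebra 529 (2019) 268–535 = arXiv:1412.0868: Thm. 1.1, Thm. 1.5,
  §4.1 (LU). [CossartPiltant2019]
-/

noncomputable section

open IsLocalRing Polynomial

namespace Literature.AlgebraicGeometry.Resolution

universe u

/-- **Thm. 1.5 (weak form) from Thm. 1.1 as printed** (Cossart–Piltant 2019): the hypersurface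
ring `S[x]`, `x` a root of the monic `h`, is a quasi-excellent domain of dimension three with
fraction field `L`, contained in every valuation ring of `L` containing `S`; Thm. 1.1 along the
valuation (`CossartPiltant2019General.exists_fg_regular`) refines it to `S[x][t] ⊆ O` regular at the
centre. [cite: CossartPiltant2019, Thm. 1.1 with §4.1 (LU), Thm. 1.5] -/
theorem CossartPiltant2019General.cossartPiltant2019Local (hG : CossartPiltant2019General.{u}) :
    CossartPiltant2019Local.{u} := by
  intro p hp S _ _ _ hS hdim hchar K _ _ _ L _ _ _ _ h x hmon hdeg hirr hx hgen hcase O hSO hdom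
  classical
  haveI : IsNoetherianRing S := hS.isUniversallyCatenaryRing.1
  -- `x` is integral over `S`, hence lies in `O`
  have hxint : IsIntegral S x := ⟨h, hmon, hx⟩
  have hinjSL : Function.Injective (algebraMap S L) := by
    rw [IsScalarTower.algebraMap_eq S K L]
    exact (algebraMap K L).injective.comp (IsFractionRing.injective S K)
  letI : Algebra S O := ((algebraMap S L).codRestrict O.toSubring hSO).toAlgebra
  haveI : IsScalarTower S O L := IsScalarTower.of_algebraMap_eq fun _ => rfl
  have hvO : O.valuation.Integers O :=
    { hom_inj := Subtype.val_injective
      map_le_one := fun y => (O.valuation_le_one_iff _).mpr y.2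
      exists_of_le_one := fun r hr => ⟨⟨r, (O.valuation_le_one_iff r).mp hr⟩, rfl⟩ }
  have hxO : x ∈ O :=
    (O.valuation_le_one_iff x).mp (hvO.isIntegral_iff_v_le_one.mp hxint.tower_top)
  -- the model `B = S[x] ⊆ O`
  set B : Subalgebra S L := Algebra.adjoin S ({x} : Set L) with hBdef
  have hBO : ∀ b : B, (b : L) ∈ O := by
    intro b
    refine Algebra.adjoin_induction (p := fun y _ => y ∈ O) ?_ ?_ ?_ ?_ b.2
    · intro y hy
      rw [Set.mem_singleton_iff.mp hy]
      exact hxO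
    · exact fun s => hSO s
    · exact fun _ _ _ _ hy hz => add_mem hy hz
    · exact fun _ _ _ _ hy hz => mul_mem hy hz
  -- `B` is integral over `S`, of dimension three, quasi-excellent
  haveI : Algebra.IsIntegral S B := Algebra.IsIntegral.adjoin fun y hy => by
    rw [Set.mem_singleton_iff.mp hy]; exact hxint
  have hinjSB : Function.Injective (algebraMap S B) := fun a b hab =>
    hinjSL (by
      have h1 := congrArg (fun z : B => (z : L)) hab
      rw [IsScalarTower.algebraMap_apply S B L a, IsScalarTower.algebraMap_apply S B L b]
      exact h1)
  have hdimB : ringKrullDim B ≤ 3 := by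
    rw [ringKrullDim_eq_of_isIntegral (R := S) (S := B) hinjSB, hdim]
  haveI : Algebra.FiniteType S B :=
    (Subalgebra.fg_iff_finiteType _).mp ⟨{x}, by rw [hBdef, Finset.coe_singleton]⟩
  have hqe : IsQuasiExcellentRing B := Stacks07QU_holds S B hS.isQuasiExcellentRing inferInstance
  -- `Frac B = L`
  haveI : FaithfulSMul B L := (faithfulSMul_iff_algebraMap_injective B L).mpr Subtype.val_injective
  have hfrac : IsFractionRing B L := by
    refine IsFractionRing.of_field B L fun z => ?_
    have hz : z ∈ Algebra.adjoin K ({x} : Set L) := by rw [hgen]; exact Algebra.mem_top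
    rw [Algebra.adjoin_singleton_eq_range_aeval] at hz
    obtain ⟨q, rfl⟩ := (AlgHom.mem_range _).mp hz
    obtain ⟨b, hbM, hb⟩ := IsLocalization.integerNormalization_spec (nonZeroDivisors S) q
    have hb0 : algebraMap S L b ≠ 0 := fun h0 =>
      nonZeroDivisors.ne_zero hbM (hinjSL (by rw [h0, map_zero]))
    have hcalc : algebraMap S L b * aeval x q =
        aeval x (IsLocalization.integerNormalization (nonZeroDivisors S) q) := by
      rw [← Polynomial.aeval_map_algebraMap K x (IsLocalization.integerNormalization _ q), hb,
        Algebra.smul_def, Polynomial.algebraMap_apply, map_mul, Polynomial.aeval_C,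
        ← IsScalarTower.algebraMap_apply]
    refine ⟨⟨aeval x (IsLocalization.integerNormalization (nonZeroDivisors S) q),
      Polynomial.aeval_mem_adjoin_singleton S x⟩, ⟨algebraMap S L b, B.algebraMap_mem b⟩, ?_⟩
    change aeval x q = aeval x (IsLocalization.integerNormalization (nonZeroDivisors S) q) /
      algebraMap S L b
    rw [eq_div_iff hb0, mul_comm]
    exact hcalc
  -- Thm. 1.1 along the valuation, over `B`
  have hBO' : ∀ b : B, algebraMap B L b ∈ O := hBO
  obtain ⟨T, hT, hTfg, hreg⟩ := hG.exists_fg_regular Stacks07QU_holds hqe hdimB O hBO'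
  obtain ⟨t, rfl⟩ := hTfg
  -- `B[t] = S[x, t]`: the two descriptions have the same local ring at the centre
  have hEq : Algebra.adjoin S (insert x (t : Set L)) =
      (Algebra.adjoin B (t : Set L)).restrictScalars S := by
    rw [Set.insert_eq]
    exact Algebra.adjoin_union_eq_adjoin_adjoin S _ _
  have ht : (Algebra.adjoin S (insert x (t : Set L))).toSubring ≤ O.toSubring := by
    intro y hy
    rw [hEq] at hy
    exact hT hy
  set P₁ : Ideal ((Algebra.adjoin B (t : Set L)).restrictScalars S) :=
    Ideal.comap (Subring.inclusion hT) (maximalIdeal O) with hP₁def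
  haveI : P₁.IsPrime := Ideal.IsPrime.comap _
  have hP₁ : ∀ y : (Algebra.adjoin B (t : Set L)).restrictScalars S,
      y ∈ P₁ ↔ O.valuation (y : L) < 1 := fun y => by
    rw [hP₁def, Ideal.mem_comap, ValuationSubring.valuation_lt_one_iff]; rfl
  have hreg₁ : IsRegularLocalRing (Localization.AtPrime P₁) := hreg
  set P₂ : Ideal (Algebra.adjoin S (insert x (t : Set L))) :=
    Ideal.comap (Subring.inclusion ht) (maximalIdeal O) with hP₂def
  haveI : P₂.IsPrime := Ideal.IsPrime.comap _
  have hP₂ : ∀ y : Algebra.adjoin S (insert x (t : Set L)),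
      y ∈ P₂ ↔ O.valuation (y : L) < 1 := fun y => by
    rw [hP₂def, Ideal.mem_comap, ValuationSubring.valuation_lt_one_iff]; rfl
  exact ⟨t, ht, (isRegularLocalRing_localization_iff_of_subalgebra_eq O hEq.symm P₁ hP₁ P₂
    hP₂).mp hreg₁⟩

end Literature.AlgebraicGeometry.Resolution

end
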